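import Summits.RiemannHypothesis.RiemannHypothesis.Theorems.ScrewManifestCertResidual

/-!
# Route `IntegerScrew` — a kernel checker for PRIMAL manifest (structured-SOS) certificates of `S_M`

Item `CensusBracketsRefPassed` / `CensusBracketsCertified` of `Theorems/ScrewManifestCertDefs.lean`
(sos-theory gen15–17) type the SOS census of the SCREW column (HOME/sos/census/engine-B/ddcone/,
rh-explicit-sos-eng-2) as conjunctions of `Rung n lo hi := ¬ ManifestCert n (1/10) lo ∧ ManifestCert n (1/10) hi`.
This file is the kernel import of the FEASIBLE («hi») side: a computable Boolean checker `pcCore`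
(and the packaged `pcCheck` for `n + 1 ≤ 64`) whose success PROVES `ManifestCert n tmin T`, i.e. that
`S_{n+1} − Σ_k w_k A_{t_k} − w_J·J` is STRICTLY diagonally dominant for the listed atoms
`tmin ≤ t_k ≤ T`, `w_k = ω_k t_k² ≥ 0`, `w_J ≥ 0` (format sos-cert/v1 of the census, typed verbatim by
`ManifestCert`).

Method (RH-free, prime-free numerics; everything inside `decide +kernel`, standard axioms):
* the entries of `S_{n+1}` are enclosed by the tree's engine of `IntegerScrewRungCert{Defs,Series,Sound}`
  (`S = T(C)`, `T(C) = T(c_lo) + ((C − c_lo)/4)(I + J)`, `tEncl ∋ T(c_lo)_ij`, `c_lo ≤ C = ζ(2,¼) ≤ c_hi`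
  from `ScrewManifestCertResidual.lerchC_le_cHiQ`);
* the atom entries `A_t(i,j)·t² = 1 − cos(t x_i) − cos(t x_j) + cos(t x_i)cos(t x_j) + sin(t x_i)sin(t x_j)`
  (`x_i = log(i+2)`, addition theorem) are enclosed from `FI.cosSin (t · log(i+2))`
  (`Literature.Analysis.ValidatedNumerics`, scale `2^48`);
* the remainder's diagonal entries get integer LOWER bounds, the off-diagonal ones integer bounds of
  their absolute value, and the row test `Σ_{j ≠ i} |R_ij| < R_ii` is decided in `ℤ`.
The certificate (atoms `t_k ∈ ℚ`, reduced weights `ω_k = w_k/t_k² ∈ ℚ`, `w_J ∈ ℚ`) is a literal supplied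
by the instance files (`IntegerScrewCensusBracketsRung8`, …), read off the census `cert.json` files.
Nothing in this file bears on the truth of RH: a manifest certificate at height `T` is a finite
RH-free statement about the explicit matrix `S_{n+1}` (Suzuki2023 (1.1), (1.4)) [Suzuki2023].
-/

set_option linter.dupNamespace false
set_option autoImplicit false

namespace Summit.RiemannHypothesis.RiemannHypothesis.Theorems.IntegerScrew.Manifest

open Literature.NumberTheory.LFunctions Matrix
open Literature.Analysis.ValidatedNumerics Literature.Analysis.ValidatedNumerics.Numerics Finset

section Primal

/-! ### The checker (computable) -/

/-- Junk `(cos, sin)` enclosure pair `([-1,1], [-1,1])` for out-of-range lookups. -/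
def pcTriv : FI × FI := (⟨-(SC : ℤ), SC⟩, ⟨-(SC : ℤ), SC⟩)

/-- Enclosure of the node `x_i = log(i+2)` from a logarithm table. -/
def pcX (logs : List FI) (i : ℕ) : FI := RungCert.lg logs (i + 2)

/-- For one frequency enclosure `T ∋ t`: the `n` pairs `(cos, sin)(t x_i)`, `i < n`. -/
def pcRow (logs : List FI) (n : ℕ) (T : FI) : List (FI × FI) :=
  (List.range n).map fun i => FI.cosSin (T.mul (pcX logs i))

/-- The table of all `(cos, sin)(t_k x_i)`: row `k` belongs to the atom `t_k = ts[k]`. -/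
def pcTab (logs : List FI) (n : ℕ) (ts : List ℚ) : List (List (FI × FI)) :=
  ts.map fun t => pcRow logs n (FI.ofRat t)

/-- Lookup of the `(k, i)` pair in the table (junk `pcTriv` out of range). -/
def pcCS (tab : List (List (FI × FI))) (k i : ℕ) : FI × FI := (tab.getD k []).getD i pcTriv

/-- `I · q` for a rational `q` (outward rounding: `(I · num) / den`). -/
def pcMulRat (I : FI) (q : ℚ) : FI := (I.mulInt q.num).divNat q.den

/-- Enclosure of `t²·A_t(i,j) = 1 − cos a − cos b + (cos a cos b + sin a sin b)` from the two pairs. -/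
def pcAtom (ci cj : FI × FI) : FI :=
  (((FI.ofInt 1).sub ci.1).sub cj.1).add ((ci.1.mul cj.1).add (ci.2.mul cj.2))

/-- Interval sum `Σ_{k<K} f k` by structural recursion. -/
def pcSum (f : ℕ → FI) : ℕ → FI
  | 0 => FI.ofInt 0
  | K + 1 => (pcSum f K).add (f K)

/-- Enclosure of the PSD part `P_ij = Σ_{k<K} ω_k · t_k² A_{t_k}(i,j) + w_J` of the certificate. -/
def pcP (tab : List (List (FI × FI))) (os : List ℚ) (wJ : ℚ) (K i j : ℕ) : FI :=
  (pcSum (fun k => pcMulRat (pcAtom (pcCS tab k i) (pcCS tab k j)) (os.getD k 0)) K).add (FI.ofRat wJ)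

/-- Scaled integer bound `⌈2^48 (c_hi − c_lo)/4⌉` of the unknown rank-one excess `(C − c_lo)/4 ≥ 0`. -/
def pcD : ℤ := ⌈(cHiQ - RungCert.cLoQ) / 4 * (SC : ℚ)⌉

/-- Enclosure of the OFF-diagonal remainder entry `R_ij = T(c_lo)_ij + (C − c_lo)/4 − P_ij`. -/
def pcOffEncl (utab : List (List FI)) (tab : List (List (FI × FI))) (os : List ℚ) (wJ : ℚ)
    (K i j : ℕ) : FI :=
  ((RungCert.tEncl utab i j).add ⟨0, pcD⟩).sub (pcP tab os wJ K i j)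

/-- Scaled integer LOWER bound of the diagonal remainder entry `R_ii ≥ T(c_lo)_ii − P_ii`. -/
def pcDiagLo (utab : List (List FI)) (tab : List (List (FI × FI))) (os : List ℚ) (wJ : ℚ)
    (K i : ℕ) : ℤ :=
  (RungCert.tEncl utab i i).lo - (pcP tab os wJ K i i).hi

/-- Integer sum `Σ_{j<m} f j` by structural recursion. -/
def pcSumZ (f : ℕ → ℤ) : ℕ → ℤ
  | 0 => 0
  | m + 1 => pcSumZ f m + f m

/-- The row test `Σ_{j<n, j≠i} |R_ij|⁺ < R_ii⁻` in scaled integers. -/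
def pcRowOK (utab : List (List FI)) (tab : List (List (FI × FI))) (os : List ℚ) (wJ : ℚ)
    (K n i : ℕ) : Bool :=
  decide (pcSumZ (fun j => if j = i then 0 else (pcOffEncl utab tab os wJ K i j).absHi) n <
    pcDiagLo utab tab os wJ K i)

/-- Admissibility of the atom list: equal lengths, `tmin ≤ t_k ≤ T`, `0 < t_k`, `0 ≤ ω_k`. -/
def pcAtomsOK (ts os : List ℚ) (tmin T : ℚ) : Bool :=
  decide (os.length = ts.length) &&
    (List.range ts.length).all fun k =>
      decide (tmin ≤ ts.getD k 0) && decide (ts.getD k 0 ≤ T) && decide (0 < ts.getD k 0) &&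
        decide (0 ≤ os.getD k 0)

/-- The CORE checker, tables supplied: log table `logs` (`log m`, `m ≤ n+1`) and `utab`
(`u(a,b) = Ψ(log(a/b)) − C/4`, `1 ≤ b < a ≤ n+1`). -/
def pcCore (n : ℕ) (logs : List FI) (utab : List (List FI)) (ts os : List ℚ) (wJ tmin T : ℚ) : Bool :=
  let tab := pcTab logs n ts
  let K := ts.length
  pcAtomsOK ts os tmin T && decide (0 ≤ wJ) &&
    (List.range n).all fun i => pcRowOK utab tab os wJ K n i

/-- The PACKAGED checker for `n + 1 ≤ 64`: the engine's own log table and `uTable`. -/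
def pcCheck (n : ℕ) (ts os : List ℚ) (wJ tmin T : ℚ) : Bool :=
  let logs := FI.logTable (n + 1)
  FI.logTableOK (n + 1) &&
    match RungCert.slopeEncl logs with
    | none => false
    | some A => pcCore n logs (RungCert.uTable logs A n) ts os wJ tmin T

/-! ### Soundness of the pieces -/

/-- Soundness of `pcSum`. -/
theorem mem_pcSum {f : ℕ → FI} {v : ℕ → ℝ} :
    ∀ K : ℕ, (∀ k, k < K → FI.mem (v k) (f k)) → FI.mem (∑ k ∈ range K, v k) (pcSum f K)
  | 0, _ => by simpa [pcSum] using FI.mem_ofInt 0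
  | K + 1, h => by
    rw [Finset.sum_range_succ]
    exact FI.mem_add (mem_pcSum K fun k hk => h k (by omega)) (h K (by omega))

/-- `pcSumZ` is the `Finset.range` sum. -/
theorem pcSumZ_eq (f : ℕ → ℤ) : ∀ m : ℕ, pcSumZ f m = ∑ j ∈ range m, f j
  | 0 => by simp [pcSumZ]
  | m + 1 => by rw [pcSumZ, Finset.sum_range_succ, pcSumZ_eq f m]

/-- Soundness of `pcMulRat`. -/
theorem mem_pcMulRat {x : ℝ} {I : FI} (h : FI.mem x I) (q : ℚ) :
    FI.mem (x * (q : ℝ)) (pcMulRat I q) := by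
  have h1 := FI.mem_divNat (FI.mem_mulInt h q.num) q.den_pos
  have hq : (q : ℝ) = (q.num : ℝ) / (q.den : ℝ) := by
    rw [← Rat.num_div_den q]; push_cast; rw [Rat.num_div_den q]
  rw [hq, mul_div_assoc']
  exact h1

/-- Soundness of `pcAtom` (addition theorem form of `t² A_t(i,j)`). -/
theorem mem_pcAtom {a b : ℝ} {ci cj : FI × FI} (hc1 : FI.mem (Real.cos a) ci.1)
    (hs1 : FI.mem (Real.sin a) ci.2) (hc2 : FI.mem (Real.cos b) cj.1) (hs2 : FI.mem (Real.sin b) cj.2) :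
    FI.mem (1 - Real.cos a - Real.cos b + (Real.cos a * Real.cos b + Real.sin a * Real.sin b))
      (pcAtom ci cj) := by
  have h1 : FI.mem (1 : ℝ) (FI.ofInt 1) := by simpa using FI.mem_ofInt 1
  exact FI.mem_add (FI.mem_sub (FI.mem_sub h1 hc1) hc2) (FI.mem_add (FI.mem_mul hc1 hc2) (FI.mem_mul hs1 hs2))

/-- Table lookup: the `(k, i)` pair is `FI.cosSin (t_k · x_i)`. -/
theorem pcCS_pcTab (logs : List FI) (n : ℕ) (ts : List ℚ) {k i : ℕ} (hk : k < ts.length) (hi : i < n) :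
    pcCS (pcTab logs n ts) k i = FI.cosSin ((FI.ofRat (ts.getD k 0)).mul (pcX logs i)) := by
  unfold pcCS pcTab pcRow
  simp only [List.getD_eq_getElem?_getD, List.getElem?_map, List.getElem?_eq_getElem hk,
    List.getElem?_range hi, Option.map_some, Option.getD_some]

variable {n : ℕ} {logs : List FI}

/-- `x_i = log(i+2) ∈ pcX logs i` for a sound log table. -/
theorem mem_pcX (hL : ∀ m : ℕ, m ≤ n + 1 → FI.mem (Real.log m) (RungCert.lg logs m)) {i : ℕ}
    (hi : i < n) : FI.mem (Real.log ((i + 2 : ℕ) : ℝ)) (pcX logs i) :=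
  hL (i + 2) (by omega)

/-- Soundness of the `(cos, sin)(t_k x_i)` enclosures. -/
theorem mem_pcCS (hL : ∀ m : ℕ, m ≤ n + 1 → FI.mem (Real.log m) (RungCert.lg logs m)) (ts : List ℚ)
    {k i : ℕ} (hk : k < ts.length) (hi : i < n) :
    FI.mem (Real.cos ((ts.getD k 0 : ℝ) * Real.log ((i + 2 : ℕ) : ℝ))) (pcCS (pcTab logs n ts) k i).1 ∧
      FI.mem (Real.sin ((ts.getD k 0 : ℝ) * Real.log ((i + 2 : ℕ) : ℝ))) (pcCS (pcTab logs n ts) k i).2 := by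
  rw [pcCS_pcTab logs n ts hk hi]
  exact FI.mem_cosSin (FI.mem_mul (FI.mem_ofRat _) (mem_pcX hL hi))

/-- The real PSD part `P_ij` of the certificate (ℕ indices). -/
noncomputable def pcPReal (ts os : List ℚ) (wJ : ℚ) (i j : ℕ) : ℝ :=
  (∑ k ∈ range ts.length, (os.getD k 0 : ℝ) *
      (1 - Real.cos ((ts.getD k 0 : ℝ) * Real.log ((i + 2 : ℕ) : ℝ))
        - Real.cos ((ts.getD k 0 : ℝ) * Real.log ((j + 2 : ℕ) : ℝ))
        + (Real.cos ((ts.getD k 0 : ℝ) * Real.log ((i + 2 : ℕ) : ℝ))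
            * Real.cos ((ts.getD k 0 : ℝ) * Real.log ((j + 2 : ℕ) : ℝ))
          + Real.sin ((ts.getD k 0 : ℝ) * Real.log ((i + 2 : ℕ) : ℝ))
            * Real.sin ((ts.getD k 0 : ℝ) * Real.log ((j + 2 : ℕ) : ℝ))))) + (wJ : ℝ)

/-- Soundness of `pcP`. -/
theorem mem_pcP (hL : ∀ m : ℕ, m ≤ n + 1 → FI.mem (Real.log m) (RungCert.lg logs m)) (ts os : List ℚ)
    (wJ : ℚ) {i j : ℕ} (hi : i < n) (hj : j < n) :
    FI.mem (pcPReal ts os wJ i j) (pcP (pcTab logs n ts) os wJ ts.length i j) := by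
  unfold pcPReal pcP
  refine FI.mem_add (mem_pcSum _ fun k hk => ?_) (FI.mem_ofRat wJ)
  have h1 := mem_pcCS hL ts hk hi
  have h2 := mem_pcCS hL ts hk hj
  have := mem_pcMulRat (mem_pcAtom h1.1 h1.2 h2.1 h2.2) (os.getD k 0)
  rw [mul_comm] at this
  exact this

/-- The remainder entry of the certificate `t_k = ts[k]`, `w_k = ω_k t_k²`, `w_J`, in closed form:
`R_ij = S_ij − P_ij`. -/
theorem remainder_apply_eq (ts os : List ℚ) (wJ : ℚ) (hpos : ∀ k, k < ts.length → 0 < ts.getD k 0)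
    (i j : Fin n) :
    remainder n ts.length (fun k => ((ts.getD k 0 : ℚ) : ℝ))
        (fun k => ((os.getD k 0 : ℚ) : ℝ) * ((ts.getD k 0 : ℚ) : ℝ) ^ 2) (wJ : ℝ) i j =
      screwMatrix n i j - pcPReal ts os wJ i j := by
  unfold remainder pcPReal
  simp only [Matrix.sub_apply, Matrix.sum_apply, Matrix.smul_apply, smul_eq_mul, waveAtom, onesMat,
    node, Matrix.of_apply, mul_one]
  rw [Fin.sum_univ_eq_sum_range (fun k => ((os.getD k 0 : ℚ) : ℝ) * ((ts.getD k 0 : ℚ) : ℝ) ^ 2 *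
    ((1 - Real.cos (((ts.getD k 0 : ℚ) : ℝ) * Real.log (((i : ℕ) + 2 : ℕ) : ℝ))
      - Real.cos (((ts.getD k 0 : ℚ) : ℝ) * Real.log (((j : ℕ) + 2 : ℕ) : ℝ))
      + Real.cos (((ts.getD k 0 : ℚ) : ℝ) *
          (Real.log (((i : ℕ) + 2 : ℕ) : ℝ) - Real.log (((j : ℕ) + 2 : ℕ) : ℝ)))) /
        ((ts.getD k 0 : ℚ) : ℝ) ^ 2)) ts.length]
  have hsum : ∀ k ∈ range ts.length,
      ((os.getD k 0 : ℚ) : ℝ) * ((ts.getD k 0 : ℚ) : ℝ) ^ 2 *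
        ((1 - Real.cos (((ts.getD k 0 : ℚ) : ℝ) * Real.log (((i : ℕ) + 2 : ℕ) : ℝ))
          - Real.cos (((ts.getD k 0 : ℚ) : ℝ) * Real.log (((j : ℕ) + 2 : ℕ) : ℝ))
          + Real.cos (((ts.getD k 0 : ℚ) : ℝ) *
              (Real.log (((i : ℕ) + 2 : ℕ) : ℝ) - Real.log (((j : ℕ) + 2 : ℕ) : ℝ)))) /
            ((ts.getD k 0 : ℚ) : ℝ) ^ 2) =
      ((os.getD k 0 : ℚ) : ℝ) *
        (1 - Real.cos (((ts.getD k 0 : ℚ) : ℝ) * Real.log (((i : ℕ) + 2 : ℕ) : ℝ))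
          - Real.cos (((ts.getD k 0 : ℚ) : ℝ) * Real.log (((j : ℕ) + 2 : ℕ) : ℝ))
          + (Real.cos (((ts.getD k 0 : ℚ) : ℝ) * Real.log (((i : ℕ) + 2 : ℕ) : ℝ))
              * Real.cos (((ts.getD k 0 : ℚ) : ℝ) * Real.log (((j : ℕ) + 2 : ℕ) : ℝ))
            + Real.sin (((ts.getD k 0 : ℚ) : ℝ) * Real.log (((i : ℕ) + 2 : ℕ) : ℝ))
              * Real.sin (((ts.getD k 0 : ℚ) : ℝ) * Real.log (((j : ℕ) + 2 : ℕ) : ℝ)))) := by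
    intro k hk
    rw [Finset.mem_range] at hk
    have ht : ((ts.getD k 0 : ℚ) : ℝ) ≠ 0 := by exact_mod_cast (hpos k hk).ne'
    rw [mul_sub, Real.cos_sub]
    field_simp
  rw [Finset.sum_congr rfl hsum]
  ring

/-- **SOUNDNESS of the core checker.** With a valid logarithm table for `m ≤ n+1` and a valid
`u`-table for `1 ≤ b < a ≤ n+1`, `pcCore n logs utab ts os wJ tmin T = true` proves
`ManifestCert n tmin T` with the witness `t_k = ts[k]`, `w_k = os[k]·ts[k]²`, `w_J = wJ`. -/
theorem manifestCert_of_pcCore {utab : List (List FI)}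
    (hL : ∀ m : ℕ, m ≤ n + 1 → FI.mem (Real.log m) (RungCert.lg logs m))
    (hut : ∀ a b : ℕ, 0 < b → b < a → a ≤ n + 1 → FI.mem (RungCert.uR a b) (RungCert.ug utab a b))
    {ts os : List ℚ} {wJ tmin T : ℚ} (h : pcCore n logs utab ts os wJ tmin T = true) :
    ManifestCert n (tmin : ℝ) (T : ℝ) := by
  classical
  unfold pcCore at h
  simp only [Bool.and_eq_true, List.all_eq_true, List.mem_range, decide_eq_true_eq] at h
  obtain ⟨⟨hat, hwJ⟩, hrows⟩ := h
  unfold pcAtomsOK at hat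
  simp only [Bool.and_eq_true, List.all_eq_true, List.mem_range, decide_eq_true_eq] at hat
  obtain ⟨hlen, hk⟩ := hat
  have hpos : ∀ k, k < ts.length → 0 < ts.getD k 0 := fun k hk' => (hk k hk').1.2
  refine ⟨ts.length, fun k => ((ts.getD k 0 : ℚ) : ℝ),
    fun k => ((os.getD k 0 : ℚ) : ℝ) * ((ts.getD k 0 : ℚ) : ℝ) ^ 2, (wJ : ℝ), fun k => ?_,
    by exact_mod_cast hwJ, fun i => ?_⟩
  · obtain ⟨⟨⟨h1, h2⟩, h3⟩, h4⟩ := hk k k.isLt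
    refine ⟨?_, ?_, ?_, ?_⟩
    · show ((tmin : ℚ) : ℝ) ≤ ((ts.getD k 0 : ℚ) : ℝ)
      exact_mod_cast h1
    · show ((ts.getD k 0 : ℚ) : ℝ) ≤ ((T : ℚ) : ℝ)
      exact_mod_cast h2
    · show (0 : ℝ) < ((ts.getD k 0 : ℚ) : ℝ)
      exact_mod_cast h3
    · show (0 : ℝ) ≤ ((os.getD k 0 : ℚ) : ℝ) * ((ts.getD k 0 : ℚ) : ℝ) ^ 2
      exact mul_nonneg (by exact_mod_cast h4) (sq_nonneg _)
  · -- the row `i`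
    have hS : (0 : ℝ) < SC := SC_pos
    have hrow := hrows i i.isLt
    unfold pcRowOK at hrow
    rw [decide_eq_true_eq, pcSumZ_eq] at hrow
    set tab := pcTab logs n ts with htab
    set K := ts.length with hK
    -- entries of `S_{n+1}`
    have hSentry : ∀ a b : Fin n, screwMatrix n a b =
        RungCert.tMat ((RungCert.cLoQ : ℚ) : ℝ) n a b +
          (RungCert.lerchC - ((RungCert.cLoQ : ℚ) : ℝ)) / 4 * ((1 : Matrix (Fin n) (Fin n) ℝ) a b + 1) := by
      intro a b
      rw [RungCert.screwMatrix_eq_tMat, RungCert.tMat_split RungCert.lerchC ((RungCert.cLoQ : ℚ) : ℝ)]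
      simp only [Matrix.add_apply, Matrix.smul_apply, Matrix.vecMulVec_apply, smul_eq_mul, mul_one]
    have hClo : ((RungCert.cLoQ : ℚ) : ℝ) ≤ RungCert.lerchC := RungCert.cLoQ_le_lerchC
    have hChi : RungCert.lerchC ≤ ((cHiQ : ℚ) : ℝ) := lerchC_le_cHiQ
    have hDmem : FI.mem ((RungCert.lerchC - ((RungCert.cLoQ : ℚ) : ℝ)) / 4) ⟨0, pcD⟩ := by
      constructor
      · push_cast
        exact mul_nonneg (div_nonneg (sub_nonneg.2 hClo) (by norm_num)) hS.le
      · have h1 : (RungCert.lerchC - ((RungCert.cLoQ : ℚ) : ℝ)) / 4 * SC ≤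
            (((cHiQ - RungCert.cLoQ) / 4 * (SC : ℚ) : ℚ) : ℝ) := by
          push_cast
          exact mul_le_mul_of_nonneg_right (div_le_div_of_nonneg_right (by linarith) (by norm_num)) hS.le
        exact h1.trans (by exact_mod_cast Int.le_ceil _)
    have htE : ∀ a b : Fin n, FI.mem (RungCert.tMat ((RungCert.cLoQ : ℚ) : ℝ) n a b)
        (RungCert.tEncl utab a b) := by
      intro a b
      have := RungCert.mem_tEncl hut a.isLt b.isLt
      simpa using this
    have hP : ∀ a b : Fin n, FI.mem (pcPReal ts os wJ a b) (pcP tab os wJ K a b) :=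
      fun a b => mem_pcP hL ts os wJ a.isLt b.isLt
    have hR := remainder_apply_eq (n := n) ts os wJ hpos
    -- diagonal
    have hdiag : (pcDiagLo utab tab os wJ K i : ℝ) ≤
        remainder n K (fun k => ((ts.getD k 0 : ℚ) : ℝ))
          (fun k => ((os.getD k 0 : ℚ) : ℝ) * ((ts.getD k 0 : ℚ) : ℝ) ^ 2) (wJ : ℝ) i i * SC := by
      rw [hR, hSentry, Matrix.one_apply_eq]
      unfold pcDiagLo
      push_cast
      have h1 := (htE i i).1
      have h2 := (hP i i).2
      have h3 : 0 ≤ (RungCert.lerchC - ((RungCert.cLoQ : ℚ) : ℝ)) / 4 * (1 + 1) * SC :=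
        mul_nonneg (mul_nonneg (div_nonneg (sub_nonneg.2 hClo) (by norm_num)) (by norm_num)) hS.le
      nlinarith
    -- off-diagonal
    have hoff : ∀ j : Fin n, j ≠ i →
        |remainder n K (fun k => ((ts.getD k 0 : ℚ) : ℝ))
          (fun k => ((os.getD k 0 : ℚ) : ℝ) * ((ts.getD k 0 : ℚ) : ℝ) ^ 2) (wJ : ℝ) i j| * SC ≤
        ((pcOffEncl utab tab os wJ K i j).absHi : ℝ) := by
      intro j hji
      apply FI.abs_le_absHi
      rw [hR, hSentry, Matrix.one_apply_ne (Ne.symm hji), zero_add, mul_one]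
      exact FI.mem_sub (FI.mem_add (htE i j) hDmem) (hP i j)
    -- the sum
    have hsum : (∑ j ∈ Finset.univ.erase i,
        |remainder n K (fun k => ((ts.getD k 0 : ℚ) : ℝ))
          (fun k => ((os.getD k 0 : ℚ) : ℝ) * ((ts.getD k 0 : ℚ) : ℝ) ^ 2) (wJ : ℝ) i j|) * SC ≤
        ∑ j ∈ range n, (if j = (i : ℕ) then (0 : ℝ) else ((pcOffEncl utab tab os wJ K i j).absHi : ℝ)) := by
      rw [Finset.sum_mul, ← Fin.sum_univ_eq_sum_range (fun j => (if j = (i : ℕ) then (0 : ℝ)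
        else ((pcOffEncl utab tab os wJ K i j).absHi : ℝ))) n,
        ← Finset.sum_erase (Finset.univ) (a := i) (by simp)]
      refine Finset.sum_le_sum fun j hj => ?_
      have hji : j ≠ i := Finset.ne_of_mem_erase hj
      have hji' : (j : ℕ) ≠ (i : ℕ) := fun h => hji (Fin.ext h)
      rw [if_neg hji']
      exact hoff j hji
    have hlt : (∑ j ∈ range n, (if j = (i : ℕ) then (0 : ℝ)
        else ((pcOffEncl utab tab os wJ K i j).absHi : ℝ))) < (pcDiagLo utab tab os wJ K i : ℝ) := by
      have h1 := (Int.cast_lt (R := ℝ)).2 hrow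
      push_cast at h1
      exact h1
    have := lt_of_le_of_lt hsum (lt_of_lt_of_le hlt hdiag)
    exact lt_of_mul_lt_mul_right this hS.le

/-- **SOUNDNESS of the packaged checker** (`n + 1 ≤ 64`; the engine's log table and `uTable`). -/
theorem manifestCert_of_pcCheck (hn : n + 1 ≤ 64) (hn2 : 1 ≤ n) {ts os : List ℚ} {wJ tmin T : ℚ}
    (h : pcCheck n ts os wJ tmin T = true) : ManifestCert n (tmin : ℝ) (T : ℝ) := by
  unfold pcCheck at h
  rw [Bool.and_eq_true] at h
  obtain ⟨hok, hm⟩ := h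
  have hL : ∀ m : ℕ, m ≤ n + 1 → FI.mem (Real.log m) (RungCert.lg (FI.logTable (n + 1)) m) :=
    RungCert.logsOK_of_eq rfl hok
  split at hm
  · exact absurd hm (by simp)
  · rename_i A hA
    have hAv : FI.mem RungCert.slopeA A := RungCert.mem_slopeEncl hL (by omega) hA
    have hut : ∀ a b : ℕ, 0 < b → b < a → a ≤ n + 1 →
        FI.mem (RungCert.uR a b) (RungCert.ug (RungCert.uTable (FI.logTable (n + 1)) A n) a b) := by
      intro a b hb hba ha
      rw [RungCert.ug_uTable hba ha]
      exact RungCert.mem_uEncl hL hn hAv hb hba ha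
    exact manifestCert_of_pcCore hL hut hm

end Primal

end Summit.RiemannHypothesis.RiemannHypothesis.Theorems.IntegerScrew.Manifest
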